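import Literature.MathematicalPhysics.QuantumFieldTheory.Balaban1983to89.B9Eq3130GtildeTransferTower
import Literature.MathematicalPhysics.QuantumFieldTheory.Balaban1983to89.B9Eq3152ProjGreenPrimeGradRowClosed
import Literature.MathematicalPhysics.QuantumFieldTheory.Balaban1983to89.B9Eq325RofUkSupRowClosed
import Literature.MathematicalPhysics.QuantumFieldTheory.Balaban1983to89.B9Eq3117GaugeModeStencilLettersTower
import Literature.MathematicalPhysics.QuantumFieldTheory.Balaban1983to89.B9Eq326G1kSliceGradRowClosed
import Literature.MathematicalPhysics.QuantumFieldTheory.Balaban1983to89.B9Eq326G1kDivergenceRowClosed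

/-!
# `Balaban1983to89.B9Eq3130GtildeGradRowClosed` — T. Bałaban, *Propagators for lattice gauge theories in a background field*, Commun. Math. Phys. **99** (1985)
# 389–434 [Balaban1985BackgroundPropagators] Thm 3.13 p. 426 (*«the operator G̃ … satisfies (3.42)–(3.47)»*) with (3.130) p. 421, Thm 3.3 p. 399, Thm 3.1 (3.42)
# p. 397, and [Balaban1985Variational] (115)–(117) pp. 294–295 — **THE VALUE, DIVERGENCE AND GRADIENT ROWS OF PRINT's `G̃_k = Δ̃_{a,k}(U)⁻¹` (the inverse of
# (3.122), `G′ := G′_k`) ON THE pub-balaban NE9 CHAIN's DIAGONAL, `∃ (α₁, B, δ)` BEFORE THE HEIGHT, THE PERIOD AND THE BACKGROUND — the (3.130) transfer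
# `G₀ = G1k ↦ G̃_k` DISCHARGED on the cell's model letters plus print's weight `c₀ = η^d` and print's third window (3.36) in the shape `‖J‖ ≤ α`**

statement-level skeleton of published theorems with citation tags; proofs where landed; nothing here is a claim about the Yang–Mills mass gap

CITATION HEADER (lean-in-tree rule).  Audit cell `pub-balaban`, sub-cell `t4`, BINDER row NE9; filed by the NE9 BINDER-row OWNER lineage `b2b-balaban-t4-ne9-p1`
(gen 97) as the (T4′) END of the RIGHT road (ruling R-ne9p1-g97-2 l.66097 adopting t4-ne9-idea-1 g155 N55; settlement A-2 l.66177: the PAIR road's END (K76)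
`B9Eq3130GtildePairRowsClosed` — value + divergence rows — is ne9-leaf-05 g88's; the two roads share no file below the suppliers and give the pricing desk an
independent cross-check of those two rows).  Source READ first-hand this generation (`paper:balaban1985-cmp99-background-propagators`, journal page = PDF page +
388): p. 421 (3.130), p. 426 Thm 3.13, p. 419 (3.117)–(3.120), p. 396 (3.34)–(3.36), p. 392 (3.10)–(3.11); [B11] p. 295 (116)–(118) (the VALUE member of (117) asks
exactly these rows of `𝔊̃_k = 𝔓_kG̃_k`).  COMPOSED BY NAME, nothing restated: §1 of `B9Eq3130GtildeTransferTower` (this lineage) and the `∃`-first suppliers —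
ne9-leaf-05 g87's (K64) `B9Eq326G1kSupRowClosed.exists_local_letter_G1k`, ne9-leaf-03's (DGK) `B9Eq326G1kDivergenceRowClosed.exists_divergence_row_G1k`, this lineage's
(E2) `B9Eq326G1kSliceGradRowClosed.exists_local_gradLetter_G1k` (g96), ne9-leaf-05 g88's (K76a) `B9Eq325RofUkSupRowClosed.exists_local_letters_GpOfUk_RofUk` and g87's
(K70) `B9Eq3152GreenPrimeProjGradRowClosed.exists_local_gradLetter_GpRk`, ne9-leaf-03 g80's (T2) `B9Eq3152ProjGreenPrimeGradRowClosed.exists_local_gradLetter_RkGp`,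
ne9-leaf-05 g88's (K75) `B9Eq3117GaugeModeStencilLettersTower.local_hessOp_covDerivL2K_tower`∕`local_covDivL2K_hessOp_tower` (over this lineage's (K73)
`B9Eq3117HessOpGaugeMode` and (F2) `B9Eq3117DivHessOpGaugeMode`), `B9Eq326LocalPartTowerSliceGradientRow.norm_covGrad_apply_le_of_slice`.

WHAT IS PROVED (sorry-free; proof lane — 0 `def`; [folklore] composition of landed letters).  ONE theorem, **`exists_local_rows_G1kPi`**:
`∃ α₁ B δ, 0 < α₁ ∧ 0 ≤ B ∧ 0 < δ ∧ ∀ ⟨the binder block of (E2) `exists_local_gradLetter_G1k` VERBATIM: height `n`, `η L^{n+1} = 1`, weights with `c₀(L^{n+1})^d = c₁`,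
period `m`, background `U` with its per-level data, the window `α ≤ α₁` in its three members `αη`, `αη²`, `αη²`, the positivity witness `hpos′`⟩ (hpos : positivity of
`Δ_{a,k}`, as (K64)) (hposπ : positivity of `Δ̃_{a,k}` = [B9] Thm 3.11 for the invariant operator, DISPLAYED) (hc₀ : `c₀ = η^d` — print's (3.11); with `hηL`, `hw`
it says `c₁ = 1`) (hJ : `‖J(μ,y)‖ ≤ α` — print's third window (3.36) in the shape the (3.117) stencils consume it, the FOURTH window member with the SAME `α`)
(v f F) (f supported over the unit block `v`, bonds at `Π(b₋)`, `‖f‖_∞ ≤ F`) (μ b y),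
`‖(G̃_kf)(b)‖ ≤ B·e^{−δ·d_m(Π(b₋),v)}·F ∧ ‖(D*_UG̃_kf)(y)‖ ≤ B·e^{−δ·d_m(Π(y),v)}·F ∧ ‖(D_U(G̃_kf)_μ)(b)‖ ≤ B·e^{−δ·d_m(Π(b₊),v)}·F ∧ ‖(∇_UG̃_kf)(b,μ)‖ ≤ B·e^{−δ·d_m(Π(b₊),v)}·F`
with `G̃_k = G1LatticeK hposπ`.  Constants: `κ₀ = min` of the six suppliers' rates, `δ = κ₀∕8`; the stencil letters enter with `ε = 2M_φM_φ′αe^{κ₀}`,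
`ε′ = 2dM_φM_φ′αe^{κ₀}` so that §1's `q = α·Q` (`Q` explicit in the suppliers' constants); `α₁ = min(suppliers' windows, 1∕(2(QK′² + 1)))` makes `qK′² ≤ 1∕2`,
`1∕(1 − qK′²) ≤ 2`, and `B = B_Σ + 2α₁QK′B_ΣK′`, `B_Σ = B₀ + B₁ + B_X` dominates the three row constants.
WHY (cell context).  Plan v15 (R-ne9p1-g97-1): by (3.117) the Hessian on gauge modes is the ORDER-ZERO current commutator, so `Δ′_πG₀` has one-sided letters of
size `α` and the Neumann series (3.130) is a bootstrap ((K71)); with this file EVERY row the (117) VALUE member asks of `G̃_k` is a landed `∃`-first letter on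
the model (the GRADIENT member of (117) — second derivatives, print's Hölder rows (3.43)–(3.45) — is STOREY H, R-ne9p1-g97-3, not touched here).
HONEST SCOPE.  `hposπ`, `hc₀`, `hJ` are HYPOTHESES of printed shape ((3.36) ⟹ `‖J‖ = O(α)` is print's p. 419 sentence «J is small if U satisfies (3.36)», NOT
derived here from the three window members; `hposπ` is Thm 3.11's conclusion for `Δ̃_{a,k}` — ANY witness here, INHABITED in a window by this lineage's
`B9Thm311LaplaceAkPiPositiveDiagonal.exists_laplaceAkPi_pos_diagonal_closed`, not re-proved); the rows are the model's sup-letters, not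
print's kernel norms (3.42)–(3.47); nothing of [B9] Thm 3.3∕3.11∕3.12∕3.13, (3.36), (3.131)–(3.133) or [B11] (117)∕Prop. 4 is asserted, valued or discharged;
«NE9 ⇐ the named binders»; NE9 NOT PRINTED ∕ NOT PROVED; row WALLED ON A MODEL (O-NE9-1; #5 UNRULED); spine PROVED 0∕9; rung (B)+1 on a finite T⁴ — NOT
infinite volume, NOT mass gap, NOT BetaPertH, NOT Clay.  HONEST DEPENDENCY: continuum YM on T⁴ ⇐ BetaPertH ∧ nine spine estimates (0/9 proved); BetaPertH ⇐
(D1) ∧ (D4) ∧ CAP+tail; G-an2-4 gates asym, D1 and NE2/3/4.  NEW file importing six modules (`B9Eq3130GtildeTransferTower`, `B9Eq3152ProjGreenPrimeGradRowClosed`,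
`B9Eq325RofUkSupRowClosed`, `B9Eq3117GaugeModeStencilLettersTower`, `B9Eq326G1kSliceGradRowClosed`, `B9Eq326G1kDivergenceRowClosed`); nothing modified.  Net new
unproved facts: 0.
-/

noncomputable section

set_option autoImplicit false

open scoped InnerProductSpace ComplexConjugate BigOperators

namespace Literature.MathematicalPhysics.QuantumFieldTheory.Balaban1983to89.B9Eq3130GtildeGradRowClosed

open B4Sect5Torus (TSite tdist tdist_nonneg)
open B4Sect5Proof (latticeConst latticeConst_nonneg)
open B9SectCLatticeCarrier (Bond bpos btgt unshift)
open B9Eq311L2Pairing (WL2)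
open B9Eq33CovDerivVector (covGrad)
open B9Eq319QprimeTorus (blockCoord)
open B7Prop1Explicit (U1 Wcx boxVec)
open B11Eq103H1Complex (SiteL2K BondL2K covDerivL2K covDivL2K G1LatticeK)
open B9Eq310DeltaPrime (plaqHolU)
open B9Eq310HessianOperator (adTransportW hessOp)
open B9Eq310HessianHermitian (adTransportW_adjoint)
open B9Eq315QTorus (perCfg cornerSite)
open B9Eq315QTower (towerP UlevOf)
open B9Eq316TowerFlatIsOneStep (towerP_eq_fineP_pow siteCast)
open B9Eq326OperatorTower (laplaceAk G1k RofUk)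
open B9Eq324DeltaPrimeATower (laplacePrimeAk GpOfUk)
open B9Eq3119DeltaPiTower (laplaceAkPi)
open B9Eq3130GtildeTransferTower (letter_transfer_tower)
open B9Eq326LocalPartTowerSliceGradientRow (norm_covGrad_apply_le_of_slice)
open B9Eq326G1kSupRowClosed (exists_local_letter_G1k)
open B9Eq326G1kDivergenceRowClosed (exists_divergence_row_G1k)
open B9Eq326G1kSliceGradRowClosed (exists_local_gradLetter_G1k)
open B9Eq3152GreenPrimeProjGradRowClosed (exists_local_gradLetter_GpRk)
open B9Eq3152ProjGreenPrimeGradRowClosed (exists_local_gradLetter_RkGp)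
open B9Eq325RofUkSupRowClosed (exists_local_letters_GpOfUk_RofUk)
open B9Eq3117GaugeModeStencilLettersTower (local_hessOp_covDerivL2K_tower local_covDivL2K_hessOp_tower)

/-! ## §0 Bookkeeping -/

/-- Weakening a letter value: `B·e^{−κD}·F ≤ B′·e^{−κ′D}·F` for `0 ≤ B ≤ B′`, `κ′ ≤ κ`, `0 ≤ D`, `0 ≤ F`. [folklore] -/
private theorem weaken {B B' κ κ' D F : ℝ} (hB : 0 ≤ B) (hBB : B ≤ B') (hκ : κ' ≤ κ) (hD : 0 ≤ D) (hF : 0 ≤ F) :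
    B * Real.exp (-(κ * D)) * F ≤ B' * Real.exp (-(κ' * D)) * F := by
  refine mul_le_mul_of_nonneg_right ?_ hF
  refine mul_le_mul hBB (Real.exp_le_exp.2 ?_) (Real.exp_nonneg _) (hB.trans hBB)
  nlinarith [mul_le_mul_of_nonneg_right hκ hD]

/-! ## §1 BEFORE THE HEIGHT: the value, divergence and gradient rows of print's `G̃_k` on the cell's diagonal, `∃ (α₁, B, δ)` first -/

section AllHeights

variable {d : ℕ} (hd : 1 ≤ d) (L : ℕ) [NeZero L] (hL : 1 ≤ L) (hL3 : 3 ≤ L)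
  {𝔸 : Type*} [NormedRing 𝔸] [NormedAlgebra ℂ 𝔸] [CompleteSpace 𝔸] [NormOneClass 𝔸] [StarRing 𝔸] [NormedStarGroup 𝔸] [StarModule ℂ 𝔸]
  {W : Type*} [NormedAddCommGroup W] [InnerProductSpace ℂ W] [FiniteDimensional ℂ W] (φ : W ≃ₗ[ℂ] 𝔸)
  {Mφ Mφ' : ℝ} (hMφ : 0 ≤ Mφ) (hMφ' : 0 ≤ Mφ') (hφ : ∀ w, ‖φ w‖ ≤ Mφ * ‖w‖) (hφ' : ∀ X, ‖φ.symm X‖ ≤ Mφ' * ‖X‖) (hstar : ∀ X : 𝔸, ‖star X‖ ≤ ‖X‖)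
  {a : ℝ} (ha : 0 < a) {a' : ℝ} (ha' : 0 < a') {ϱ : ℝ} (hϱ0 : 0 ≤ ϱ) (hϱ1 : ϱ < 1)
  (τ : 𝔸 →ₗ[ℂ] ℂ) {Cτ : ℝ} (hτ : ∀ X, ‖τ X‖ ≤ Cτ * ‖X‖) (hCτ : 0 ≤ Cτ) {Mτ : ℝ} (hτm : ∀ X Y : 𝔸, ‖τ (X * Y)‖ ≤ Mτ * ‖X‖ * ‖Y‖) (hMτ : 0 ≤ Mτ)
  {ρw : ℝ} (hρw : 0 ≤ ρw)
  (hτ₁ : ∀ X : 𝔸, τ (star X) = conj (τ X)) (hτ₂ : ∀ X Y : 𝔸, τ (X * Y) = τ (Y * X)) (hφτ : ∀ X Y : 𝔸, ⟪φ.symm X, φ.symm Y⟫_ℂ = τ (star X * Y))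
  (AQ : ℝ)

/-- `1∕(1 − t) ≤ 2` for `t ≤ 1∕2`. [folklore] -/
private theorem one_div_one_sub_le_two {t : ℝ} (ht : t ≤ 1 / 2) : 1 / (1 - t) ≤ 2 := by
  rw [div_le_iff₀ (by linarith)]; linarith

set_option maxHeartbeats 400000 in -- six `∃`-first suppliers with ≈ 40 binders each, §1 applied three times: the defeq assembly exceeds the default budget
include hd hL hL3 hMφ hMφ' hφ hφ' hstar ha ha' hϱ0 hϱ1 hτ hCτ hτm hMτ hρw hτ₁ hτ₂ hφτ in
/-- **THE VALUE, DIVERGENCE AND (SLICE ∕ COVARIANT) GRADIENT ROWS OF PRINT's `G̃_k = Δ̃_{a,k}(U)⁻¹` (`G1LatticeK hposπ`, the inverse of (3.122) with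
`G′ := G′_k`) ON THE CELL's DIAGONAL, `∃ (α₁, B, δ)` BEFORE THE HEIGHT, THE PERIOD AND THE BACKGROUND** — the (3.130) transfer `G₀ = G1k ↦ G̃` DISCHARGED on the
NE9 chain's model letters: the binder block of (E2) `B9Eq326G1kSliceGradRowClosed.exists_local_gradLetter_G1k` VERBATIM, plus the positivity witnesses `hpos`
(of `Δ_{a,k}`, as (K64)) and `hposπ` (of `Δ̃_{a,k}`), print's weight `hc₀ : c₀ = η^d` ((3.11); with `hηL`, `hw` this is `c₁ = 1`) and print's third window (3.36)
in the shape `hJ : ‖J(b)‖ ≤ α` (the current `J = D*η⁻²Im ∂U` of (3.11)∕(3.117), SAME `α` as the other three window members).  For every source `f` supported over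
ONE unit block `v` (bonds read at `Π(b₋)`) with `‖f‖_∞ ≤ F`, every `μ`, bond `b` and site `y`:
`‖(G̃f)(b)‖ ≤ B·e^{−δ·d_m(Π(b₋),v)}·F`, `‖(D*_UG̃f)(y)‖ ≤ B·e^{−δ·d_m(Π(y),v)}·F`, `‖(D_U(G̃f)_μ)(b)‖ ≤ B·e^{−δ·d_m(Π(b₊),v)}·F`, `‖(∇_UG̃f)(b,μ)‖ ≤ B·e^{−δ·d_m(Π(b₊),v)}·F`.
Suppliers (all `∃`-first, composed BY NAME through §1): (K64) `exists_local_letter_G1k`, (DGK) `exists_divergence_row_G1k`, (E2) `exists_local_gradLetter_G1k`,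
ne9-leaf-05's `exists_local_letters_GpOfUk_RofUk` and (K70) `exists_local_gradLetter_GpRk`, ne9-leaf-03's (T2) `exists_local_gradLetter_RkGp`, ne9-leaf-05's (K75)
stencil letters `local_hessOp_covDerivL2K_tower`∕`local_covDivL2K_hessOp_tower` over this lineage's (K73)∕(F2); `δ = κ₀∕8`, `κ₀ = min` of the six rates; `α₁` is
the suppliers' window shrunk so that `α₁·Q·K′² ≤ 1∕2` (`q = α·Q`). [cite: Balaban1985BackgroundPropagators, (3.130) p.421, Thm 3.13 p.426, Thm 3.3 p.399, Thm 3.1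
(3.42) p.397, (3.117) p.419, (3.36) p.396, (3.122) p.420; Balaban1985Variational, (115) p.294, (117) p.295] -/
theorem exists_local_rows_G1kPi :
    ∃ α₁ B δ : ℝ, 0 < α₁ ∧ 0 ≤ B ∧ 0 < δ ∧
      ∀ (n : ℕ) (η : ℝ) (_hηL : η * (L : ℝ) ^ (n + 1) = 1) (c₀ c₁ : ℝ) [Fact (0 < c₀)] [Fact (0 < c₁)]
        (_hw : c₀ * ((L : ℝ) ^ (n + 1)) ^ d = c₁) (_hρ : |η| ^ d / c₀ ≤ ρw) (m : Fin d → ℕ) [∀ i, NeZero (m i)] (_hm : ∀ i, 1 ≤ m i)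
        (U : Bond d (towerP L m (n + 1)) → 𝔸ˣ) (αU : ℕ → ℝ) (_hα0 : ∀ j, 0 ≤ αU j) (hα1 : ∀ j, αU j ≤ 1 / 64)
        (hU1 : ∀ (j : ℕ) (x : B7Prop1Explicit.Site d) (k : Fin d), perCfg (towerP L m (j + 1)) (UlevOf L m (n + 1) U j) x k ∈ U1 𝔸)
        (hreg : ∀ (j : ℕ) (y : TSite d (towerP L m j)) (k : Fin d) (ρ' : Fin d → Fin L),
          ‖((Wcx L (perCfg (towerP L m (j + 1)) (UlevOf L m (n + 1) U j)) (cornerSite L y) k (boxVec L ρ') : 𝔸ˣ) : 𝔸) - 1‖ ≤ αU j)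
        (εU : ℕ → ℝ) (_hεU : ∀ j, 0 ≤ εU j) (_hUε : ∀ (j : ℕ) (b : Bond d (towerP L m (j + 1))), ‖(UlevOf L m (n + 1) U j b : 𝔸) - 1‖ ≤ εU j)
        (_hLb : ∀ (j : ℕ) (b : Bond d (towerP L m (j + 1))), UlevOf L m (n + 1) U j b ∈ U1 𝔸)
        (α : ℝ) (_hα : 0 ≤ α) (_hαle : α ≤ α₁)
        (hUst : ∀ b, star (U b : 𝔸) = (((U b)⁻¹ : 𝔸ˣ) : 𝔸)) (_hUb : ∀ b, U b ∈ U1 𝔸) (_hUη : ∀ b, ‖(U b : 𝔸) - 1‖ ≤ α * η)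
        (_hpl : ∀ p : B9SectCLatticeCarrier.Plaq d (towerP L m (n + 1)), ‖(plaqHolU U p : 𝔸) - 1‖ ≤ α * η ^ 2)
        (_hUgrad : ∀ (x : TSite d (towerP L m (n + 1))) (μ : Fin d), ‖(U (x, μ) : 𝔸) - U (unshift μ x, μ)‖ ≤ α * η ^ 2)
        (_hRlev : ∀ (j : ℕ) (b : Bond d (towerP L m (j + 1))) (w : W), ‖adTransportW φ (UlevOf L m (n + 1) U j) b w‖ ≤ ‖w‖)
        (_hεg : ∀ j < n + 1, εU j ≤ α * ϱ ^ j) (_hAQ : ∑ j ∈ Finset.range (n + 1), αU j ≤ AQ)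
        (hpos' : ∀ x : SiteL2K ℂ d (towerP L m (n + 1)) c₀ W, x ≠ 0 → 0 < RCLike.re ⟪x, laplacePrimeAk L m n φ η U a' (c₁ := c₁) x⟫_ℂ)
        (hpos : ∀ x : BondL2K ℂ d (towerP L m (n + 1)) c₀ W, x ≠ 0 →
          0 < RCLike.re ⟪x, laplaceAk L m n φ η U hL αU hα1 hU1 hreg τ (c₀ := c₀) (c₁ := c₁) a x⟫_ℂ)
        (hposπ : ∀ x : BondL2K ℂ d (towerP L m (n + 1)) c₀ W, x ≠ 0 →
          0 < RCLike.re ⟪x, laplaceAkPi L m n φ τ η U a' hpos' hL αU hα1 hU1 hreg (c₁ := c₁) a x⟫_ℂ)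
        (_hc₀ : c₀ = η ^ d)
        (_hJ : ∀ (μ : Fin d) (y : TSite d (towerP L m (n + 1))),
          ‖B9Eq39Adjoint.J (fun μ => B9Eq33CovDerivVector.shiftEquiv μ) (fun μ y => U (y, μ)) η μ y‖ ≤ α)
        (v : TSite d m) (f : BondL2K ℂ d (towerP L m (n + 1)) c₀ W) (F : ℝ)
        (_hfv : ∀ b, blockCoord (L ^ (n + 1)) m (siteCast (towerP_eq_fineP_pow L m (n + 1)) (bpos b)) ≠ v →
          WL2.equiv ℂ (fun _ : Bond d (towerP L m (n + 1)) => c₀) W f b = 0)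
        (_hfF : ∀ b, ‖WL2.equiv ℂ (fun _ : Bond d (towerP L m (n + 1)) => c₀) W f b‖ ≤ F) (μ : Fin d) (b : Bond d (towerP L m (n + 1)))
        (y : TSite d (towerP L m (n + 1))),
        ‖WL2.equiv ℂ (fun _ : Bond d (towerP L m (n + 1)) => c₀) W (G1LatticeK hposπ f) b‖ ≤
            B * Real.exp (-(δ * tdist m (blockCoord (L ^ (n + 1)) m (siteCast (towerP_eq_fineP_pow L m (n + 1)) (bpos b))) v)) * F ∧
          ‖WL2.equiv ℂ (fun _ : TSite d (towerP L m (n + 1)) => c₀) W (covDivL2K ℂ c₀ ((η : ℂ))⁻¹ (adTransportW φ fun bb => (U bb)⁻¹)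
              (G1LatticeK hposπ f)) y‖ ≤
            B * Real.exp (-(δ * tdist m (blockCoord (L ^ (n + 1)) m (siteCast (towerP_eq_fineP_pow L m (n + 1)) y)) v)) * F ∧
          ‖WL2.equiv ℂ (fun _ : Bond d (towerP L m (n + 1)) => c₀) W (covDerivL2K ℂ c₀ ((η : ℂ))⁻¹ (adTransportW φ U)
              ((WL2.equiv ℂ (fun _ : TSite d (towerP L m (n + 1)) => c₀) W).symm fun y' =>
                WL2.equiv ℂ (fun _ : Bond d (towerP L m (n + 1)) => c₀) W (G1LatticeK hposπ f) (y', μ))) b‖ ≤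
            B * Real.exp (-(δ * tdist m (blockCoord (L ^ (n + 1)) m (siteCast (towerP_eq_fineP_pow L m (n + 1)) (btgt b))) v)) * F ∧
          ‖covGrad ((η : ℂ))⁻¹ (adTransportW φ U) (WL2.equiv ℂ (fun _ : Bond d (towerP L m (n + 1)) => c₀) W (G1LatticeK hposπ f)) (b, μ)‖ ≤
            B * Real.exp (-(δ * tdist m (blockCoord (L ^ (n + 1)) m (siteCast (towerP_eq_fineP_pow L m (n + 1)) (btgt b))) v)) * F := by
  classical
  -- the six `∃`-first suppliers
  obtain ⟨αV, BV, δV, hαV, hBV, hδV, HV⟩ := exists_local_letter_G1k hd L hL hL3 φ hMφ hMφ' hφ hφ' hstar ha ha' hϱ0 hϱ1 τ hτ hCτ hτm hMτ hρw hτ₁ hτ₂ hφτ AQ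
  obtain ⟨αS, BS, δS, hαS, hBS, hδS, HS⟩ := exists_divergence_row_G1k hd L hL hL3 φ hMφ hMφ' hφ hφ' hstar ha ha' hϱ0 hϱ1 τ hτ hCτ hτm hMτ hρw hτ₁ hτ₂ hφτ AQ
  obtain ⟨αX, BXg, δX, hαX, hBXg, hδX, HX⟩ := exists_local_gradLetter_G1k hd L hL hL3 φ hMφ hMφ' hφ hφ' hstar ha ha' hϱ0 hϱ1 τ hτ hCτ hτm hMτ hρw hτ₁ hτ₂ hφτ AQ
  obtain ⟨αP, BP, δP, hαP, hBP, hδP, HP⟩ := exists_local_letters_GpOfUk_RofUk hd L hL hL3 φ hMφ hMφ' hφ hφ' ha ha' hϱ0 hϱ1 τ hτ hCτ hMτ hρw hτ₁ hτ₂ hφτ AQ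
  obtain ⟨α3, B3, δ3, hα3, hB3, hδ3, H3⟩ := exists_local_gradLetter_GpRk hd L hL hL3 φ hMφ hMφ' hφ hφ' ha ha' hϱ0 hϱ1 τ hτ hCτ hMτ hρw hτ₁ hτ₂ hφτ AQ
  obtain ⟨α4, B4, δ4, hα4, hB4, hδ4, H4⟩ := exists_local_gradLetter_RkGp hd L hL hL3 φ hMφ hMφ' hφ hφ' ha ha' hϱ0 hϱ1 τ hτ hCτ hMτ hρw hτ₁ hτ₂ hφτ AQ
  -- one window, one rate, the constants of §1
  obtain ⟨κ₀, hκ₀d⟩ : ∃ κ₀ : ℝ, κ₀ = min (min (min δV δS) (min δX δP)) (min δ3 δ4) := ⟨_, rfl⟩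
  have hκ₀ : 0 < κ₀ := by rw [hκ₀d]; exact lt_min (lt_min (lt_min hδV hδS) (lt_min hδX hδP)) (lt_min hδ3 hδ4)
  have hκV : κ₀ ≤ δV := by rw [hκ₀d]; exact ((min_le_left _ _).trans (min_le_left _ _)).trans (min_le_left _ _)
  have hκS : κ₀ ≤ δS := by rw [hκ₀d]; exact ((min_le_left _ _).trans (min_le_left _ _)).trans (min_le_right _ _)
  have hκX : κ₀ ≤ δX := by rw [hκ₀d]; exact ((min_le_left _ _).trans (min_le_right _ _)).trans (min_le_left _ _)
  have hκP : κ₀ ≤ δP := by rw [hκ₀d]; exact ((min_le_left _ _).trans (min_le_right _ _)).trans (min_le_right _ _)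
  have hκ3 : κ₀ ≤ δ3 := by rw [hκ₀d]; exact (min_le_right _ _).trans (min_le_left _ _)
  have hκ4 : κ₀ ≤ δ4 := by rw [hκ₀d]; exact (min_le_right _ _).trans (min_le_right _ _)
  obtain ⟨αm, hαmd⟩ : ∃ αm : ℝ, αm = min (min (min αV αS) (min αX αP)) (min α3 α4) := ⟨_, rfl⟩
  have hαm : 0 < αm := by rw [hαmd]; exact lt_min (lt_min (lt_min hαV hαS) (lt_min hαX hαP)) (lt_min hα3 hα4)
  have hmV : αm ≤ αV := by rw [hαmd]; exact ((min_le_left _ _).trans (min_le_left _ _)).trans (min_le_left _ _)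
  have hmS : αm ≤ αS := by rw [hαmd]; exact ((min_le_left _ _).trans (min_le_left _ _)).trans (min_le_right _ _)
  have hmX : αm ≤ αX := by rw [hαmd]; exact ((min_le_left _ _).trans (min_le_right _ _)).trans (min_le_left _ _)
  have hmP : αm ≤ αP := by rw [hαmd]; exact ((min_le_left _ _).trans (min_le_right _ _)).trans (min_le_right _ _)
  have hm3 : αm ≤ α3 := by rw [hαmd]; exact (min_le_right _ _).trans (min_le_left _ _)
  have hm4 : αm ≤ α4 := by rw [hαmd]; exact (min_le_right _ _).trans (min_le_right _ _)
  have hK₂ : 0 ≤ latticeConst d (κ₀ / 2) := latticeConst_nonneg d (by linarith)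
  have hK : 0 ≤ latticeConst d (κ₀ / 4) := latticeConst_nonneg d (by linarith)
  have hK' : 0 ≤ latticeConst d (κ₀ / 8) := latticeConst_nonneg d (by linarith)
  obtain ⟨Q, hQ⟩ : ∃ Q : ℝ, Q = 2 * Mφ * Mφ' * Real.exp κ₀ * BS * (BP * BP * latticeConst d (κ₀ / 2)) * latticeConst d (κ₀ / 4) ^ 2 +
      2 * d * Mφ * Mφ' * Real.exp κ₀ * (B4 * Real.exp (κ₀ * 1)) * (BV + BS * (B3 * Real.exp (κ₀ * 1)) * latticeConst d (κ₀ / 4)) *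
        latticeConst d (κ₀ / 4) ^ 2 := ⟨_, rfl⟩
  have hQ0 : 0 ≤ Q := by rw [hQ]; positivity
  obtain ⟨α₁, hα₁d⟩ : ∃ α₁ : ℝ, α₁ = min αm (1 / (2 * (Q * latticeConst d (κ₀ / 8) * latticeConst d (κ₀ / 8) + 1))) := ⟨_, rfl⟩
  have hα₁ : 0 < α₁ := by rw [hα₁d]; exact lt_min hαm (by positivity)
  have hα₁m : α₁ ≤ αm := by rw [hα₁d]; exact min_le_left _ _
  have hα₁Q : α₁ * (Q * latticeConst d (κ₀ / 8) * latticeConst d (κ₀ / 8)) ≤ 1 / 2 := by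
    have h1 : α₁ ≤ 1 / (2 * (Q * latticeConst d (κ₀ / 8) * latticeConst d (κ₀ / 8) + 1)) := by rw [hα₁d]; exact min_le_right _ _
    have hP : 0 ≤ Q * latticeConst d (κ₀ / 8) * latticeConst d (κ₀ / 8) := by positivity
    calc α₁ * (Q * latticeConst d (κ₀ / 8) * latticeConst d (κ₀ / 8))
        ≤ 1 / (2 * (Q * latticeConst d (κ₀ / 8) * latticeConst d (κ₀ / 8) + 1)) * (Q * latticeConst d (κ₀ / 8) * latticeConst d (κ₀ / 8)) :=
          mul_le_mul_of_nonneg_right h1 hP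
      _ ≤ 1 / 2 := by
          rw [div_mul_eq_mul_div, one_mul, div_le_iff₀ (by positivity)]
          nlinarith
  obtain ⟨Bs, hBs⟩ : ∃ Bs : ℝ, Bs = BV + BS + BXg := ⟨_, rfl⟩
  have hBs0 : 0 ≤ Bs := by rw [hBs]; positivity
  refine ⟨α₁, Bs + 2 * (α₁ * Q) * latticeConst d (κ₀ / 8) * Bs * latticeConst d (κ₀ / 8), κ₀ / 8, hα₁, by positivity, by positivity, ?_⟩
  intro n η hηL c₀ c₁ _ _ hw hρ m _ hm U αU hα0 hα1 hU1 hreg εU hεU hUε hLb α hα hαle hUst hUb hUη hpl hUgrad hRlev hεg hAQ hpos' hpos hposπ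
    hc₀ hJ v f F hfv hfF μ b y
  have hη : η ≠ 0 := by
    rintro rfl
    norm_num at hηL
  have hRS : ∀ (b : Bond d (towerP L m (n + 1))) (v u : W), ⟪adTransportW φ U b v, u⟫_ℂ = ⟪v, adTransportW φ (fun b => (U b)⁻¹) b u⟫_ℂ :=
    adTransportW_adjoint φ τ hτ₂ hUst hφτ
  have hF0 : 0 ≤ F := (norm_nonneg _).trans (hfF b)
  have hδ0 := tdist_nonneg m
  have hαV' : α ≤ αV := hαle.trans (hα₁m.trans hmV)
  have hαS' : α ≤ αS := hαle.trans (hα₁m.trans hmS)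
  have hαX' : α ≤ αX := hαle.trans (hα₁m.trans hmX)
  have hαP' : α ≤ αP := hαle.trans (hα₁m.trans hmP)
  have hα3' : α ≤ α3 := hαle.trans (hα₁m.trans hm3)
  have hα4' : α ≤ α4 := hαle.trans (hα₁m.trans hm4)
  -- the contraction `q·K′·K′ < 1` (`q = α·Q ≤ α₁·Q`)
  have hqQ : (2 * Mφ * Mφ' * α * Real.exp κ₀ * BS * (BP * BP * latticeConst d (κ₀ / 2)) * latticeConst d (κ₀ / 4) ^ 2 +
        2 * d * Mφ * Mφ' * α * Real.exp κ₀ * (B4 * Real.exp (κ₀ * 1)) * (BV + BS * (B3 * Real.exp (κ₀ * 1)) * latticeConst d (κ₀ / 4)) *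
          latticeConst d (κ₀ / 4) ^ 2) = α * Q := by
    rw [hQ]; ring
  have hqt : (2 * Mφ * Mφ' * α * Real.exp κ₀ * BS * (BP * BP * latticeConst d (κ₀ / 2)) * latticeConst d (κ₀ / 4) ^ 2 +
        2 * d * Mφ * Mφ' * α * Real.exp κ₀ * (B4 * Real.exp (κ₀ * 1)) * (BV + BS * (B3 * Real.exp (κ₀ * 1)) * latticeConst d (κ₀ / 4)) *
          latticeConst d (κ₀ / 4) ^ 2) * latticeConst d (κ₀ / 8) * 1 * latticeConst d (κ₀ / 8) ≤ 1 / 2 := by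
    rw [hqQ]
    calc α * Q * latticeConst d (κ₀ / 8) * 1 * latticeConst d (κ₀ / 8) = α * (Q * latticeConst d (κ₀ / 8) * latticeConst d (κ₀ / 8)) := by ring
      _ ≤ α₁ * (Q * latticeConst d (κ₀ / 8) * latticeConst d (κ₀ / 8)) := mul_le_mul_of_nonneg_right hαle (by positivity)
      _ ≤ 1 / 2 := hα₁Q
  have hq : (2 * Mφ * Mφ' * α * Real.exp κ₀ * BS * (BP * BP * latticeConst d (κ₀ / 2)) * latticeConst d (κ₀ / 4) ^ 2 +
        2 * d * Mφ * Mφ' * α * Real.exp κ₀ * (B4 * Real.exp (κ₀ * 1)) * (BV + BS * (B3 * Real.exp (κ₀ * 1)) * latticeConst d (κ₀ / 4)) *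
          latticeConst d (κ₀ / 4) ^ 2) * latticeConst d (κ₀ / 8) * 1 * latticeConst d (κ₀ / 8) < 1 := hqt.trans_lt (by norm_num)
  -- the uniform constant
  have hunif : ∀ {BXr : ℝ}, 0 ≤ BXr → BXr ≤ Bs →
      0 ≤ BXr + 1 / (1 - α * Q * latticeConst d (κ₀ / 8) * 1 * latticeConst d (κ₀ / 8)) * (α * Q) * latticeConst d (κ₀ / 8) * BXr *
          latticeConst d (κ₀ / 8) ∧
        BXr + 1 / (1 - α * Q * latticeConst d (κ₀ / 8) * 1 * latticeConst d (κ₀ / 8)) * (α * Q) * latticeConst d (κ₀ / 8) * BXr *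
            latticeConst d (κ₀ / 8) ≤ Bs + 2 * (α₁ * Q) * latticeConst d (κ₀ / 8) * Bs * latticeConst d (κ₀ / 8) := by
    intro BXr hBXr hBXrs
    have hqt' : α * Q * latticeConst d (κ₀ / 8) * 1 * latticeConst d (κ₀ / 8) ≤ 1 / 2 := by rw [← hqQ]; exact hqt
    have hM2 := one_div_one_sub_le_two hqt'
    have hM0 : 0 ≤ 1 / (1 - α * Q * latticeConst d (κ₀ / 8) * 1 * latticeConst d (κ₀ / 8)) := div_nonneg zero_le_one (by linarith)
    have hαQ : α * Q ≤ α₁ * Q := mul_le_mul_of_nonneg_right hαle hQ0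
    have hαQ0 : 0 ≤ α * Q := mul_nonneg hα hQ0
    refine ⟨by positivity, ?_⟩
    calc BXr + 1 / (1 - α * Q * latticeConst d (κ₀ / 8) * 1 * latticeConst d (κ₀ / 8)) * (α * Q) * latticeConst d (κ₀ / 8) * BXr *
          latticeConst d (κ₀ / 8)
        = BXr + 1 / (1 - α * Q * latticeConst d (κ₀ / 8) * 1 * latticeConst d (κ₀ / 8)) * ((α * Q) * latticeConst d (κ₀ / 8) * BXr *
          latticeConst d (κ₀ / 8)) := by ring
      _ ≤ Bs + 2 * ((α₁ * Q) * latticeConst d (κ₀ / 8) * Bs * latticeConst d (κ₀ / 8)) := by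
          gcongr
      _ = Bs + 2 * (α₁ * Q) * latticeConst d (κ₀ / 8) * Bs * latticeConst d (κ₀ / 8) := by ring
  -- the slice derivative as a CLM (output blocks `Π∘b₊`), the divergence as a CLM
  obtain ⟨Xμ, hXμ⟩ : ∃ T : BondL2K ℂ d (towerP L m (n + 1)) c₀ W →L[ℂ] BondL2K ℂ d (towerP L m (n + 1)) c₀ W,
      ∀ (u : BondL2K ℂ d (towerP L m (n + 1)) c₀ W) (b' : Bond d (towerP L m (n + 1))),
        WL2.equiv ℂ (fun _ : Bond d (towerP L m (n + 1)) => c₀) W (T u) b' =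
          WL2.equiv ℂ (fun _ : Bond d (towerP L m (n + 1)) => c₀) W (covDerivL2K ℂ c₀ ((η : ℂ))⁻¹ (adTransportW φ U)
            ((WL2.equiv ℂ (fun _ : TSite d (towerP L m (n + 1)) => c₀) W).symm fun y' =>
              WL2.equiv ℂ (fun _ : Bond d (towerP L m (n + 1)) => c₀) W u (y', μ))) b' :=
    ⟨LinearMap.toContinuousLinearMap (covDerivL2K ℂ c₀ ((η : ℂ))⁻¹ (adTransportW φ U) ∘ₗ
        (WL2.linearEquiv ℂ ℂ (fun _ : TSite d (towerP L m (n + 1)) => c₀)).symm.toLinearMap ∘ₗ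
        LinearMap.funLeft ℂ W (fun y' : TSite d (towerP L m (n + 1)) => ((y', μ) : Bond d (towerP L m (n + 1)))) ∘ₗ
        (WL2.linearEquiv ℂ ℂ (fun _ : Bond d (towerP L m (n + 1)) => c₀)).toLinearMap), fun _ _ => rfl⟩
  obtain ⟨Dsc, hDsc⟩ : ∃ T : BondL2K ℂ d (towerP L m (n + 1)) c₀ W →L[ℂ] SiteL2K ℂ d (towerP L m (n + 1)) c₀ W,
      T = LinearMap.toContinuousLinearMap (covDivL2K ℂ c₀ ((η : ℂ))⁻¹ (adTransportW φ fun bb => (U bb)⁻¹)) := ⟨_, rfl⟩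
  -- §1 three times
  have T := fun {X₂ : Type} [Fintype X₂] {w₂ : X₂ → ℝ} [Fact (∀ x, 0 < w₂ x)] (π₂ : X₂ → TSite d m)
      (X : BondL2K ℂ d (towerP L m (n + 1)) c₀ W →L[ℂ] WL2 ℂ w₂ W) {BX : ℝ} (hBX : 0 ≤ BX)
      (hXG₀ : ∀ (v : TSite d m) (f : BondL2K ℂ d (towerP L m (n + 1)) c₀ W) (F : ℝ),
        (∀ b, blockCoord (L ^ (n + 1)) m (siteCast (towerP_eq_fineP_pow L m (n + 1)) (bpos b)) ≠ v →
          WL2.equiv ℂ (fun _ : Bond d (towerP L m (n + 1)) => c₀) W f b = 0) →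
        (∀ b, ‖WL2.equiv ℂ (fun _ : Bond d (towerP L m (n + 1)) => c₀) W f b‖ ≤ F) →
        ∀ x, ‖WL2.equiv ℂ w₂ W (X (G1k L m n φ η U hL αU hα1 hU1 hreg τ (c₀ := c₀) (c₁ := c₁) hpos f)) x‖ ≤
          BX * Real.exp (-(κ₀ * tdist m (π₂ x) v)) * F) (x : X₂) =>
    letter_transfer_tower L m n φ τ η U hRS a' hpos' hL αU hα1 hU1 hreg a hpos hposπ hd hm π₂ X
      (B₀ := BV) (B₁ := BS) (BG := BP) (BR := BP) (B₃ := B3) (B₄ := B4) (ε := 2 * Mφ * Mφ' * α * Real.exp κ₀)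
      (ε' := 2 * d * Mφ * Mφ' * α * Real.exp κ₀) (BX := BX) (κ₀ := κ₀) hBV hBS hBP hBP hB3 hB4 (by positivity) (by positivity) hBX hκ₀
      (fun v f F hfv hfF b => (HV n η hηL c₀ c₁ hw hρ m hm U αU hα0 hα1 hU1 hreg εU hεU hUε hLb α hα hαV' hUst hUb hUη hpl hUgrad hRlev hεg hAQ
        hpos' hpos v f F hfv hfF b).trans (weaken hBV le_rfl hκV (hδ0 _ _) ((norm_nonneg _).trans (hfF b))))
      (fun v f F hfv hfF y => (HS n η hηL c₀ c₁ hw hρ m hm U αU hα0 hα1 hU1 hreg εU hεU hUε hLb α hα hαS' hUst hUb hUη hpl hUgrad hRlev hεg hAQ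
        hpos' hpos v f F hfv hfF y).trans (weaken hBS le_rfl hκS (hδ0 _ _) ((norm_nonneg _).trans (hfF (y, μ)))))
      (fun v w F hwv hwF x => (HP n η hηL c₀ c₁ hw hρ m hm U αU hα0 hα1 hU1 hreg εU hεU hUε hLb α hα hαP' hUst hUb hUη hpl hUgrad hRlev hεg hAQ
        hpos' v w F hwv hwF x).1.trans (weaken hBP le_rfl hκP (hδ0 _ _) ((norm_nonneg _).trans (hwF x))))
      (fun v w F hwv hwF x => (HP n η hηL c₀ c₁ hw hρ m hm U αU hα0 hα1 hU1 hreg εU hεU hUε hLb α hα hαP' hUst hUb hUη hpl hUgrad hRlev hεg hAQ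
        hpos' v w F hwv hwF x).2.1.trans (weaken hBP le_rfl hκP (hδ0 _ _) ((norm_nonneg _).trans (hwF x))))
      (fun v w F hwv hwF b => (H3 n η hηL c₀ c₁ hw hρ m hm U αU hα0 hα1 hU1 hreg εU hεU hUε hLb α hα hα3' hUst hUb hUη hpl hUgrad hRlev hεg hAQ
        hpos' v w F hwv hwF b).trans (weaken hB3 le_rfl hκ3 (hδ0 _ _) ((norm_nonneg _).trans (hwF (bpos b)))))
      (fun v w F hwv hwF b => (H4 n η hηL c₀ c₁ hw hρ m hm U αU hα0 hα1 hU1 hreg εU hεU hUε hLb α hα hα4' hUst hUb hUη hpl hUgrad hRlev hεg hAQ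
        hpos' v w F hwv hwF b).trans (weaken hB4 le_rfl hκ4 (hδ0 _ _) ((norm_nonneg _).trans (hwF (bpos b)))))
      (fun v s F hsv hsF b => local_hessOp_covDerivL2K_tower L m (n + 1) φ τ hτ₂ hφτ hη hUst hc₀ hUb hMφ hMφ' hφ hφ' hJ hm hκ₀.le v s F hsv hsF b)
      (fun v A F hAv hAF y => local_covDivL2K_hessOp_tower L m (n + 1) φ τ hτ₂ hφτ hη hUst hc₀ hUb hMφ hMφ' hφ hφ' hJ hm hκ₀.le v A F hAv hAF y)
      hXG₀ hq v f F hfv hfF x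
  -- the value row (`X = 1`)
  have hVal := T (fun b : Bond d (towerP L m (n + 1)) => blockCoord (L ^ (n + 1)) m (siteCast (towerP_eq_fineP_pow L m (n + 1)) (bpos b)))
    (ContinuousLinearMap.id ℂ _) hBV
    (fun v f F hfv hfF b => by
      rw [ContinuousLinearMap.coe_id', id_eq]
      exact (HV n η hηL c₀ c₁ hw hρ m hm U αU hα0 hα1 hU1 hreg εU hεU hUε hLb α hα hαV' hUst hUb hUη hpl hUgrad hRlev hεg hAQ
        hpos' hpos v f F hfv hfF b).trans (weaken hBV le_rfl hκV (hδ0 _ _) ((norm_nonneg _).trans (hfF b)))) b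
  -- the divergence row (`X = D*_U`)
  have hDiv := T (fun x : TSite d (towerP L m (n + 1)) => blockCoord (L ^ (n + 1)) m (siteCast (towerP_eq_fineP_pow L m (n + 1)) x)) Dsc hBS
    (fun v f F hfv hfF y => by
      rw [hDsc, LinearMap.coe_toContinuousLinearMap']
      exact (HS n η hηL c₀ c₁ hw hρ m hm U αU hα0 hα1 hU1 hreg εU hεU hUε hLb α hα hαS' hUst hUb hUη hpl hUgrad hRlev hεg hAQ
        hpos' hpos v f F hfv hfF y).trans (weaken hBS le_rfl hκS (hδ0 _ _) ((norm_nonneg _).trans (hfF (y, μ))))) y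
  -- the gradient row (`X =` the slice derivative, output blocks `Π∘b₊`)
  have hGrad := T (fun b : Bond d (towerP L m (n + 1)) => blockCoord (L ^ (n + 1)) m (siteCast (towerP_eq_fineP_pow L m (n + 1)) (btgt b)))
    Xμ hBXg
    (fun v f F hfv hfF b => by
      rw [hXμ]
      exact (HX n η hηL c₀ c₁ hw hρ m hm U αU hα0 hα1 hU1 hreg εU hεU hUε hLb α hα hαX' hUst hUb hUη hpl hUgrad hRlev hεg hAQ
        hpos' hpos v f F hfv hfF μ b).1.trans (weaken hBXg le_rfl hκX (hδ0 _ _) ((norm_nonneg _).trans (hfF b)))) b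
  rw [ContinuousLinearMap.coe_id', id_eq, hqQ] at hVal
  rw [hDsc, LinearMap.coe_toContinuousLinearMap', hqQ] at hDiv
  rw [hXμ, hqQ] at hGrad
  have hBV' : BV ≤ Bs := by rw [hBs]; linarith
  have hBS' : BS ≤ Bs := by rw [hBs]; linarith
  have hBXg' : BXg ≤ Bs := by rw [hBs]; linarith
  have e₁ := hVal.trans (weaken (hunif hBV hBV').1 (hunif hBV hBV').2 le_rfl (hδ0 _ _) hF0)
  have e₂ := hDiv.trans (weaken (hunif hBS hBS').1 (hunif hBS hBS').2 le_rfl (hδ0 _ _) hF0)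
  have e₃ := hGrad.trans (weaken (hunif hBXg hBXg').1 (hunif hBXg hBXg').2 le_rfl (hδ0 _ _) hF0)
  exact ⟨e₁, e₂, e₃, norm_covGrad_apply_le_of_slice _ _ _ b μ e₃⟩

end AllHeights


end Literature.MathematicalPhysics.QuantumFieldTheory.Balaban1983to89.B9Eq3130GtildeGradRowClosed

end
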